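import Summits.HodgeConjecture.HodgeConjecture.Theorems.Ring2DeformPrintedFamilies
import Summits.HodgeConjecture.HodgeConjecture.Theorems.WeilTypeLadderAbsoluteHodge
import Literature.AlgebraicGeometry.Andre1996.CompactPencilReduction
import HarnessLib

/-!
# Ring 2 · route `deform`, IV — the COMPACT-PENCIL axis (André 1996 §6.3, Remarque 2): the variational
# input asked only of compact pencils of abelian varieties; the gen-1 residual R3anc removed

HONEST FRAMING: research route conditional on HC_CM; not a corollary; Q11.4-sentence-2 already refuted in dim ≥ 3.

Cell `pub-hodge-ring2`, seat `pub-hodge-ring2-deform` (gen 5). `HC_CM` is ALWAYS the explicit hypothesis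
`Theses.RankFourFaces.CMAbelianHodge` (tree item stmt-HodgeConjecture-3052) — a binder, never an axiom, never
cited; `HC_AV` is `Theses.PadicSemiregularLift.HodgeAbelianVarieties` (stmt-HodgeConjecture-1333), read through
the guard `HodgeAbelianVarieties.Negative.iff_hodgeConjecture_restricted`; the reduction item "`HC_CM ⟹ HC_AV`"
is `Theses.RankFourFaces.CMToAbelian` (stmt-HodgeConjecture-16267, OPEN — nothing here closes it). One
`@[conjecture]` definition (an OPEN statement, a hypothesis wherever used) and theorems: no `sorry`; axioms
`propext`, `Classical.choice`, `Quot.sound`.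

## What this part adds to parts I–III

Parts I (`Ring2DeformVariationalInputs`, rows (D) (M) (E₂) (E₃)) and III (`Ring2DeformPrintedFamilies` §B)
record that the BLANKET transport input `Hypotheses.AbelianSchemeVHC` (variational Hodge for abelian schemes)
DOMINATES `HC_CM` — but every one of those kernel theorems carries, besides two tree facts (André 1992;
Deligne's tensor-anchored Weil families), the OPEN anchored leaf R3anc
`WeilTypeLadder.AnchoredWeilFamiliesCMField` of the Weil-type ladder: the NAMED RESIDUAL of this seat's gen 1
(RING2-MAP §deform D.1, row V: "in print André 1996 Lemme 6.3.3; the tree's André-1992 fact forgets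
split-ness"). The literature seat has since vendored André 1996 §6.3 ITSELF on the carrier
`Motives.IsCompactAbelianPencil` (`Literature/AlgebraicGeometry/Andre1996/CompactPencilReduction.lean`):
Lemme 6.3.1 as the named fact `andre1996_cmAnchoredPencil`, Lemmes 6.3.2–6.3.3 as the named fact
`andre1996_cmHodgeClasses_algebraicallyAnchoredPencils` (refereed theorems in print, entered below as
HYPOTHESES `h₂₁`, `h₂₂` — never internally minted statements), and the reduction PROVED
(`hodgeConjecture_abelian_of_andre1996_pencils`, `cmHodgeHypothesisAt_of_algebraicallyAnchoredPencils`). This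
file binds that reduction to the summit names:

* §A  ONE summit-side node `CompactAbelianPencilVHC`: Grothendieck's transport of algebraicity
  (`Abdulali1994.InvariantCyclesHoldFor`, global-class form) on every COMPACT PENCIL of abelian varieties —
  base a smooth projective CURVE, total space smooth projective, a section, abelian fibres
  (`Motives.IsCompactAbelianPencil f d`). It is the body of `AbelianSchemeVHC` restricted to compact
  one-dimensional bases (`compactAbelianPencilVHC_of_abelianSchemeVHC`) and ON-PATH (`HC_AV →` it, Charles–Schnell
  Cor. 11.3.6; `HodgeConjecture →` it).
* §B  DOMINATION WITHOUT R3anc: `CompactAbelianPencilVHC → HC_CM` and `AbelianSchemeVHC → HC_CM` granted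
  Lemmes 6.3.2–6.3.3 ONLY (`h₂₂`); `HC_AV ↔ CompactAbelianPencilVHC ↔ AbelianSchemeVHC` granted Lemmes
  6.3.1–6.3.3 (`h₂₁`, `h₂₂`); the Weil-type rungs R1/R3 from `AbelianSchemeVHC` with no anchored-family leaf.
  The leaf R3anc, André 1992 and `deligne1982_weilFamily_hodgeWeilSection_all` are gone from rows (D) (M) (E₂) (E₃).
* §C  THE `HC_CM`-LOAD-BEARING FORM (Lemme 6.3.1 only, `h₂₁`; Abdulali's Lemma 6.2 on compact pencils):
  `HC_AV ↔ HC_CM ∧ CompactAbelianPencilVHC` and `CMToAbelian ↔ (HC_CM → CompactAbelianPencilVHC)` — item 16267 is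
  "under `HC_CM`, variational Hodge on compact pencils of abelian varieties".
* §D  PLACEMENT against rows U / IC_MT of parts II–III, and §E one summary (`deformAxis_twoKinds`): the typed
  open inputs between `HC_CM` and `HC_AV` on the deform axis come in TWO KINDS — `HC_CM`-DOMINATING
  (`CompactAbelianPencilVHC ≡ AbelianSchemeVHC ≡ HC_AV` modulo print: `HC_CM` decorative next to them) and
  `HC_CM`-COMPLEMENTARY (U = `UniformAlgebraicityAtCMPoints`, H4, IC_MT: `HC_AV ↔ HC_CM ∧ U` with `HC_CM` not
  known to follow from U). Across the kinds only implications THROUGH `HC_AV` are kernel theorems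
  (`CompactAbelianPencilVHC → U` granted `h₂₁ h₂₂`; `HC_CM ∧ U → CompactAbelianPencilVHC` granted Thm. 11.5.11):
  a compact pencil need not be CM-dense and a CM-dense Mumford–Tate family is not compact.

## HONEST COLUMN (what the kernel theorems do NOT say)

(1) The compact-pencil input is not weaker than blanket `AbelianSchemeVHC` in any usable sense: BOTH are
equivalent to `HC_AV` modulo theorems in print (Remarque 2: "Ce théorème ramène … la conjecture de Hodge pour
les variétés abéliennes à …" a statement on compact pencils; Milne 2020 Rem. 2–3; Milne 2025 §0.0.3 "The
variational Hodge conjecture for abelian schemes implies the Hodge conjecture for abelian varieties") — the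
`iff`s of §B say exactly this. The gain is TYPING (complete one-dimensional bases: neither the theorem of the
fixed part nor mixed Hodge theory is needed to state or use the input) and the removal of the open leaf R3anc
from the domination rows. (2) `CompactAbelianPencilVHC` is OPEN; being implied by `HC_AV` (§A) it is no
independent evidence for `HC_AV`. (3) A "CM-anchored" weakening (transport only along pencils having a CM fibre,
or only out of CM fibres) would NOT make `HC_CM` load-bearing in print: the algebraic anchor `X_{s₀}` of Lemme
6.3.3 is a power of an elliptic curve `E₀` («par exemple le H¹ d'une puissance p-ième d'une courbe elliptique»,
p. 33, `V := V₀ ⊗ E`); `E₀` may be taken with complex multiplication, and then the anchor is itself a CM fibre on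
which every Hodge class is algebraic unconditionally ([KuM91] §2, as cited on p. 33) — so such an input re-derives
`HC_CM` exactly as `h₂₂` does. NOT typed (costume; our analysis, RING2-MAP §deform gen 5, D.13). (4) Row U
restricted to compact pencils is not a row either: a non-isotrivial compact pencil whose CM locus is Zariski
dense (= infinite) has as period image a compact special curve of `𝒜_d` (André–Oort for `𝒜_g`, Tsimerman 2018),
so it is, up to isogeny and finite base change, a family over a compact Shimura curve — the quaternionic habitat
families of this cell — whereas a generic curve section as in the proof of Lemme 6.3.1 has finitely many CM
fibres; our analysis, recorded in RING2-MAP §deform D.14 only. (5) Nothing here is a new case of the Hodge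
conjecture.

References (keys of `references.bib`): Andre1996Motifs (§6.3, Lemmes 6.3.1–6.3.3, Remarque 2, pp. 31–33),
Milne2020HodgeClassesAV (Rem. 2–3), Abdulali1994FamiliesAV ((1.1), Lemma 6.2, Thm. 6.1 (a)),
CharlesSchnell2014Notes (Conj. 11.3.1, Cor. 11.3.6, Thm. 11.5.11), Deligne1982HodgeCycles (Prop. 6.1; Milne's
re-edition endnote 19), Andre1992HodgeCM, Tsimerman2018AndreOortAg (honest column (4) only).
-/

noncomputable section

set_option linter.dupNamespace false

namespace Summit.HodgeConjecture.HodgeConjecture.Ring2.Deform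

open CategoryTheory AlgebraicGeometry
open Literature.AlgebraicGeometry Literature.AlgebraicGeometry.Motives
open Literature.AlgebraicGeometry.HodgeTheory
open Literature.AlgebraicGeometry.Abdulali1994 (InvariantCyclesHoldFor)
open Literature.AlgebraicGeometry.Andre1996 (andre1996_cmAnchoredPencil
  andre1996_cmHodgeClasses_algebraicallyAnchoredPencils)
open Literature.AlgebraicGeometry.Deligne1982 (deligne1982_cmDenseMumfordTateFamilies IsCMDenseMumfordTateFamilyFor)
open Summit.HodgeConjecture.HodgeConjecture
open Summit.HodgeConjecture.HodgeConjecture.WeilTypeLadder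
open Summit.HodgeConjecture.HodgeConjecture.Theses
open Summit.HodgeConjecture.HodgeConjecture.Ring2.Hypotheses (AbelianSchemeVHC)
open Summit.HodgeConjecture.HodgeConjecture.Theorems.HodgeAbelianVarieties.Negative (iff_hodgeConjecture_restricted)

/-! ## §A The node: transport of algebraicity on compact pencils of abelian varieties -/

/-- **VARIATIONAL HODGE ON COMPACT PENCILS OF ABELIAN VARIETIES** (`CompactAbelianPencilVHC`; prose: CPVHC).
For every compact pencil of abelian varieties `f : 𝒳 ⟶ S` of relative dimension `d` over `ℂ`
(`Motives.IsCompactAbelianPencil f d`: `S` a smooth projective curve, `𝒳` smooth projective of dimension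
`d + 1`, `f` a smooth projective family with a section and abelian fibres — André's «pinceau compact en variétés
abéliennes», §6.3 footnote (2)), Grothendieck's transport of algebraicity holds: a global class
`W ∈ H^{2p}(𝒳(ℂ); ℂ)` whose restriction to every fibre is rational of type `(p,p)` and which is algebraic on ONE
fibre is algebraic on EVERY fibre (`Abdulali1994.InvariantCyclesHoldFor f d`). Symbol for symbol the hypothesis
`hV` of the literature seat's `Andre1996.hodgeConjecture_abelian_of_andre1996_pencils`. OPEN (a case of the
variational Hodge conjecture; implied by `HC_AV`, `compactAbelianPencilVHC_of_HC_AV`). A HYPOTHESIS wherever used.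
[cite: Andre1996Motifs, §6.3 Remarque 2 (p. 33) and footnote (2) (p. 31)] [cite: Abdulali1994FamiliesAV, (1.1) (p. 1122)]
[cite: CharlesSchnell2014Notes, Conj. 11.3.1] -/
@[conjecture] def CompactAbelianPencilVHC : Prop :=
  ∀ ⦃d : ℕ⦄ ⦃𝒳 S : SchemeOver ℂ⦄ (f : 𝒳 ⟶ S), IsCompactAbelianPencil f d → InvariantCyclesHoldFor f d

/-- **Blanket ⟹ compact**: `AbelianSchemeVHC → CompactAbelianPencilVHC` (a compact pencil is a smooth projective
abelian family over a smooth irreducible base; the literature seat's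
`invariantCyclesHoldFor_compactPencil_of_abelianSchemes`, whose hypothesis is the body of `AbelianSchemeVHC`).
[cite: Andre1996Motifs, §6.3 Remarque 2 (p. 33)] [cite: Milne2020HodgeClassesAV, Rem. 3] -/
theorem compactAbelianPencilVHC_of_abelianSchemeVHC (hV : AbelianSchemeVHC) : CompactAbelianPencilVHC :=
  fun _ _ _ _ hf ↦ Andre1996.invariantCyclesHoldFor_compactPencil_of_abelianSchemes hV hf

/-- **ON-PATH**: `HC_AV → CompactAbelianPencilVHC` (Charles–Schnell Cor. 11.3.6 on compact pencils: every fibre is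
an abelian variety; guard `iff_hodgeConjecture_restricted`). The node never exceeds `HC_AV`.
[cite: CharlesSchnell2014Notes, Cor. 11.3.6 (p. 494)] -/
theorem compactAbelianPencilVHC_of_HC_AV (h : PadicSemiregularLift.HodgeAbelianVarieties) :
    CompactAbelianPencilVHC :=
  fun _ _ _ _ hf ↦ Andre1996.invariantCyclesHoldFor_compactPencil_of_hodgeConjecture_abelian
    (iff_hodgeConjecture_restricted.1 h) hf

/-- ON-PATH: `HodgeConjecture → CompactAbelianPencilVHC`. [folklore] -/
theorem compactAbelianPencilVHC_of_hodgeConjecture (h : _root_.HodgeConjecture) : CompactAbelianPencilVHC :=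
  compactAbelianPencilVHC_of_HC_AV (HC_AV_of_hodgeConjecture h)

/-! ## §B Domination WITHOUT the anchored leaf R3anc (André 1996 §6.3 with "motivé" ↦ "algébrique") -/

/-- **(D′) `CompactAbelianPencilVHC` PROVES `HC_CM`, granted Lemmes 6.3.2–6.3.3 only.** Every Hodge class on a
CM abelian variety lies in the span of pull-backs of classes carried by algebraically anchored compact pencils
(`h₂₂`); transport along each pencil makes them algebraic (the literature seat's
`cmHodgeHypothesisAt_of_algebraicallyAnchoredPencils`; `HC_CM = ∀ A, CMHodgeHypothesisAt A` by `Iff.rfl`,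
`Ring2Transport.HC_CM_iff_forall_cmHodgeHypothesisAt`). Compare part I (D): there the hypotheses were André 1992,
Deligne's Weil families AND the open leaf R3anc. [cite: Andre1996Motifs, Lemmes 6.3.2–6.3.3 and Remarque 2
(pp. 32–33)] [cite: Milne2020HodgeClassesAV, Rem. 2–3] -/
theorem HC_CM_of_andre1996_of_compactAbelianPencilVHC
    (h₂₂ : andre1996_cmHodgeClasses_algebraicallyAnchoredPencils) (hV : CompactAbelianPencilVHC) :
    RankFourFaces.CMAbelianHodge :=
  Ring2Transport.HC_CM_iff_forall_cmHodgeHypothesisAt.2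
    (Andre1996.cmHodgeHypothesisAt_of_algebraicallyAnchoredPencils h₂₂ hV)

/-- **(D′, blanket) `AbelianSchemeVHC` PROVES `HC_CM` granted Lemmes 6.3.2–6.3.3 only** — part I's
`HC_CM_of_abelianSchemeVHC` with {André 1992, Deligne's Weil families, R3anc} replaced by the one refereed fact.
[cite: Andre1996Motifs, §6.3 Remarque 2 (p. 33)] -/
theorem HC_CM_of_andre1996_of_abelianSchemeVHC
    (h₂₂ : andre1996_cmHodgeClasses_algebraicallyAnchoredPencils) (hV : AbelianSchemeVHC) :
    RankFourFaces.CMAbelianHodge :=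
  HC_CM_of_andre1996_of_compactAbelianPencilVHC h₂₂ (compactAbelianPencilVHC_of_abelianSchemeVHC hV)

/-- **(M′) `CompactAbelianPencilVHC ⟹ HC_AV` with NO `HC_CM` hypothesis, granted Lemmes 6.3.1–6.3.3** (André's
Thm. 0.6.2 proof with Thm. 0.5 replaced by the variational input; `HC_CM` is an intermediate conclusion, (D′)).
[cite: Andre1996Motifs, §6.3 (pp. 31–33)] [cite: Milne2020HodgeClassesAV, Rem. 2–3] -/
theorem HC_AV_of_andre1996_of_compactAbelianPencilVHC (h₂₁ : andre1996_cmAnchoredPencil)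
    (h₂₂ : andre1996_cmHodgeClasses_algebraicallyAnchoredPencils) (hV : CompactAbelianPencilVHC) :
    PadicSemiregularLift.HodgeAbelianVarieties :=
  iff_hodgeConjecture_restricted.2 (Andre1996.hodgeConjecture_abelian_of_andre1996_pencils h₂₁ h₂₂ hV)

/-- **(M′, blanket) `AbelianSchemeVHC ⟹ HC_AV` granted Lemmes 6.3.1–6.3.3** — part I (M) / part III
`HC_AV_of_abelianSchemeVHC_of_deligne1982` without André 1992, without Deligne's Weil-family and Mumford–Tate
family facts, and without R3anc. [cite: Andre1996Motifs, §6.3 Remarque 2 (p. 33)]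
[cite: Deligne1982HodgeCycles, Milne 2003 re-edition endnote 19] -/
theorem HC_AV_of_andre1996_of_abelianSchemeVHC (h₂₁ : andre1996_cmAnchoredPencil)
    (h₂₂ : andre1996_cmHodgeClasses_algebraicallyAnchoredPencils) (hV : AbelianSchemeVHC) :
    PadicSemiregularLift.HodgeAbelianVarieties :=
  HC_AV_of_andre1996_of_compactAbelianPencilVHC h₂₁ h₂₂ (compactAbelianPencilVHC_of_abelianSchemeVHC hV)

/-- **(E₂′) EXACTNESS (Remarque 2 in summit typing)**: granted Lemmes 6.3.1–6.3.3,
`HC_AV ↔ CompactAbelianPencilVHC`. [cite: Andre1996Motifs, §6.3 Remarque 2 (p. 33)]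
[cite: CharlesSchnell2014Notes, Cor. 11.3.6] -/
theorem HC_AV_iff_compactAbelianPencilVHC_of_andre1996 (h₂₁ : andre1996_cmAnchoredPencil)
    (h₂₂ : andre1996_cmHodgeClasses_algebraicallyAnchoredPencils) :
    PadicSemiregularLift.HodgeAbelianVarieties ↔ CompactAbelianPencilVHC :=
  ⟨compactAbelianPencilVHC_of_HC_AV, HC_AV_of_andre1996_of_compactAbelianPencilVHC h₂₁ h₂₂⟩

/-- **(E₂′, blanket)**: granted Lemmes 6.3.1–6.3.3, `HC_AV ↔ AbelianSchemeVHC` — part I (E₂) without R3anc.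
[cite: Andre1996Motifs, §6.3 Remarque 2 (p. 33)] [cite: CharlesSchnell2014Notes, Cor. 11.3.6] -/
theorem HC_AV_iff_abelianSchemeVHC_of_andre1996 (h₂₁ : andre1996_cmAnchoredPencil)
    (h₂₂ : andre1996_cmHodgeClasses_algebraicallyAnchoredPencils) :
    PadicSemiregularLift.HodgeAbelianVarieties ↔ AbelianSchemeVHC :=
  ⟨Hypotheses.abelianSchemeVHC_of_hc_av, HC_AV_of_andre1996_of_abelianSchemeVHC h₂₁ h₂₂⟩

/-- **Compact pencils suffice**: granted Lemmes 6.3.1–6.3.3, `AbelianSchemeVHC ↔ CompactAbelianPencilVHC` (the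
converse direction passes through `HC_AV`). [cite: Andre1996Motifs, §6.3 Remarque 2 (p. 33)] -/
theorem abelianSchemeVHC_iff_compactAbelianPencilVHC_of_andre1996 (h₂₁ : andre1996_cmAnchoredPencil)
    (h₂₂ : andre1996_cmHodgeClasses_algebraicallyAnchoredPencils) :
    AbelianSchemeVHC ↔ CompactAbelianPencilVHC :=
  ⟨compactAbelianPencilVHC_of_abelianSchemeVHC, fun hV ↦
    Hypotheses.abelianSchemeVHC_of_hc_av (HC_AV_of_andre1996_of_compactAbelianPencilVHC h₂₁ h₂₂ hV)⟩

/-- **(E₃′) What `HC_CM` is worth next to the compact-pencil input: nothing**, granted Lemmes 6.3.2–6.3.3: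
`(HC_CM ∧ CompactAbelianPencilVHC) ↔ CompactAbelianPencilVHC`. [cite: Andre1996Motifs, §6.3 Remarque 2 (p. 33)] -/
theorem HC_CM_and_compactAbelianPencilVHC_iff_of_andre1996
    (h₂₂ : andre1996_cmHodgeClasses_algebraicallyAnchoredPencils) :
    (RankFourFaces.CMAbelianHodge ∧ CompactAbelianPencilVHC) ↔ CompactAbelianPencilVHC :=
  ⟨And.right, fun hV ↦ ⟨HC_CM_of_andre1996_of_compactAbelianPencilVHC h₂₂ hV, hV⟩⟩

/-- **R3anc's job on the deform axis, done by print**: granted Lemmes 6.3.1–6.3.3, `AbelianSchemeVHC` gives the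
Weil-type rungs R1 (`WeilClassesImaginaryQuadratic`) and R3 (`WeilClassesCMField`) — part I derived R3 from
`AbelianSchemeVHC` only through the open leaf `AnchoredWeilFamiliesCMField`. (Through `HC_AV`; in print the
anchored split-Weil families ARE the pencils of Lemme 6.3.3.) [cite: Andre1996Motifs, Lemme 6.3.3 (p. 33)]
[cite: Deligne1982HodgeCycles, Thm. 4.8] -/
theorem weilRungs_of_andre1996_of_abelianSchemeVHC (h₂₁ : andre1996_cmAnchoredPencil)
    (h₂₂ : andre1996_cmHodgeClasses_algebraicallyAnchoredPencils) (hV : AbelianSchemeVHC) :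
    WeilClassesImaginaryQuadratic ∧ WeilClassesCMField :=
  ⟨weilClassesImaginaryQuadratic_of_hodgeAbelianVarieties (HC_AV_of_andre1996_of_abelianSchemeVHC h₂₁ h₂₂ hV),
    weilClassesCMField_of_hodgeAbelianVarieties (HC_AV_of_andre1996_of_abelianSchemeVHC h₂₁ h₂₂ hV)⟩

/-! ## §C The `HC_CM`-load-bearing form: Lemme 6.3.1 alone (Abdulali's Lemma 6.2 on compact pencils) -/

/-- **Row V′: `HC_CM ∧ CompactAbelianPencilVHC ⟹ HC_AV`, granted Lemme 6.3.1 only.** Through every Hodge class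
passes a compact pencil with a CM fibre (`h₂₁`); `HC_CM` makes the class algebraic THERE (consumed at the CM
fibre, by name), transport carries it back. The compact-pencil form of part III row V / Abdulali Lemma 6.2, with
Deligne's Prop. 6.1 family replaced by André's pencil. [cite: Andre1996Motifs, Lemme 6.3.1 (p. 31) and §6.3 a)
(p. 33)] [cite: Abdulali1994FamiliesAV, Lemma 6.2 (p. 1131)] -/
theorem HC_AV_of_andre1996_of_HC_CM_of_compactAbelianPencilVHC (h₂₁ : andre1996_cmAnchoredPencil)
    (hCM : RankFourFaces.CMAbelianHodge) (hV : CompactAbelianPencilVHC) :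
    PadicSemiregularLift.HodgeAbelianVarieties :=
  iff_hodgeConjecture_restricted.2 (Andre1996.hodgeConjecture_abelian_of_cmAnchoredPencil h₂₁ hV
    (Ring2Transport.HC_CM_iff_forall_cmHodgeHypothesisAt.1 hCM))

/-- **EXACTNESS of row V′**: granted Lemme 6.3.1 only, `HC_AV ↔ HC_CM ∧ CompactAbelianPencilVHC` — here `HC_CM` is a
genuine factor of the decomposition; with Lemmes 6.3.2–6.3.3 as well it is implied by the other factor ((E₃′)).
[cite: Andre1996Motifs, Lemme 6.3.1 and Remarque 2 (pp. 31–33)] [cite: CharlesSchnell2014Notes, Cor. 11.3.6] -/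
theorem HC_AV_iff_HC_CM_and_compactAbelianPencilVHC_of_andre1996 (h₂₁ : andre1996_cmAnchoredPencil) :
    PadicSemiregularLift.HodgeAbelianVarieties ↔
      (RankFourFaces.CMAbelianHodge ∧ CompactAbelianPencilVHC) :=
  ⟨fun h ↦ ⟨HC_CM_of_HC_AV h, compactAbelianPencilVHC_of_HC_AV h⟩,
    fun h ↦ HC_AV_of_andre1996_of_HC_CM_of_compactAbelianPencilVHC h₂₁ h.1 h.2⟩

/-- **`CMToAbelian ↔ (HC_CM → CompactAbelianPencilVHC)`.** Granted Lemme 6.3.1, the tree's OPEN reduction item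
"Hodge for CM abelian varieties ⟹ Hodge for all abelian varieties" (stmt-HodgeConjecture-16267) is EQUIVALENT
to "under `HC_CM`, variational Hodge on compact pencils of abelian varieties". (→): `HC_CM ∧ CMToAbelian =
HC_AV ⟹` the node (§A). (←): row V′. Compare part III §C (`↔ (HC_CM → U)`, `↔ (HC_CM → AbelianSchemeVHC)`).
[cite: Andre1996Motifs, Lemme 6.3.1 (p. 31)] [cite: CharlesSchnell2014Notes, Conj. 11.3.1 and Cor. 11.3.6] -/
theorem cmToAbelian_iff_HC_CM_imp_compactAbelianPencilVHC (h₂₁ : andre1996_cmAnchoredPencil) :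
    RankFourFaces.CMToAbelian ↔ (RankFourFaces.CMAbelianHodge → CompactAbelianPencilVHC) := by
  constructor
  · intro h hCM
    exact compactAbelianPencilVHC_of_HC_AV (Hypotheses.hc_av_iff_hc_cm_and_cmToAbelian.2 ⟨hCM, h⟩)
  · intro h hCM A _
    exact HC_AV_of_andre1996_of_HC_CM_of_compactAbelianPencilVHC h₂₁ hCM (h hCM) A

/-- **The item from the node alone**: granted Lemme 6.3.1, `CompactAbelianPencilVHC ⟹ CMToAbelian` — a typed
conditional TOWARD the open item 16267 (nothing closes it). [cite: Andre1996Motifs, Lemme 6.3.1 (p. 31)] -/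
theorem cmToAbelian_of_andre1996_of_compactAbelianPencilVHC (h₂₁ : andre1996_cmAnchoredPencil)
    (hV : CompactAbelianPencilVHC) : RankFourFaces.CMToAbelian :=
  (cmToAbelian_iff_HC_CM_imp_compactAbelianPencilVHC h₂₁).2 fun _ ↦ hV

/-- ON-PATH for §C: the right-hand side follows from the Hodge conjecture. [folklore] -/
theorem HC_CM_imp_compactAbelianPencilVHC_of_hodgeConjecture (h : _root_.HodgeConjecture) :
    RankFourFaces.CMAbelianHodge → CompactAbelianPencilVHC :=
  fun _ ↦ compactAbelianPencilVHC_of_hodgeConjecture h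

/-! ## §D Placement against rows U and IC_MT (parts II–III): implications only through `HC_AV` -/

/-- **CPVHC ⟹ U**, granted Lemmes 6.3.1–6.3.3 (through `HC_AV`; no direct comparison is claimed: row U's families
are quasi-projective CM-dense Mumford–Tate families, never compact pencils). [cite: Andre1996Motifs, §6.3
Remarque 2 (p. 33)] [cite: CharlesSchnell2014Notes, Thm. 11.5.11 and Cor. 11.3.6] -/
theorem uniformAlgebraicityAtCMPoints_of_andre1996_of_compactAbelianPencilVHC (h₂₁ : andre1996_cmAnchoredPencil)
    (h₂₂ : andre1996_cmHodgeClasses_algebraicallyAnchoredPencils) (hV : CompactAbelianPencilVHC) :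
    UniformAlgebraicityAtCMPoints :=
  uniformAlgebraicityAtCMPoints_of_HC_AV (HC_AV_of_andre1996_of_compactAbelianPencilVHC h₂₁ h₂₂ hV)

/-- **CPVHC ⟹ IC_MT** (Grothendieck's (1.1) on the printed CM-dense Mumford–Tate families), granted Lemmes
6.3.1–6.3.3 — the same predicate `InvariantCyclesHoldFor` on the OTHER class of families, again only through
`HC_AV`. [cite: Abdulali1994FamiliesAV, (1.1) (p. 1122)] [cite: Andre1996Motifs, §6.3 Remarque 2 (p. 33)] -/
theorem invariantCyclesOnMTFamilies_of_andre1996_of_compactAbelianPencilVHC (h₂₁ : andre1996_cmAnchoredPencil)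
    (h₂₂ : andre1996_cmHodgeClasses_algebraicallyAnchoredPencils) (hV : CompactAbelianPencilVHC) :
    ∀ (A : AbelianVariety ℂ) (p : ℕ) (c : complexBetti A.X (2 * p)) (𝒳 S : SchemeOver ℂ) (f : 𝒳 ⟶ S),
      IsCMDenseMumfordTateFamilyFor A p c f → InvariantCyclesHoldFor f A.dim :=
  invariantCyclesOnMTFamilies_of_HC_AV (HC_AV_of_andre1996_of_compactAbelianPencilVHC h₂₁ h₂₂ hV)

/-- **`HC_CM ∧ U ⟹ CPVHC`**, granted Charles–Schnell Thm. 11.5.11 with density (through `HC_AV`, part III row U):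
in the other direction across the two kinds `HC_CM` IS consumed. [cite: CharlesSchnell2014Notes, Thm. 11.5.11
and Cor. 11.3.6] [cite: Deligne1982HodgeCycles, Prop. 6.1] -/
theorem compactAbelianPencilVHC_of_deligne1982_of_HC_CM_of_uniform (hF : deligne1982_cmDenseMumfordTateFamilies)
    (hCM : RankFourFaces.CMAbelianHodge) (hU : UniformAlgebraicityAtCMPoints) : CompactAbelianPencilVHC :=
  compactAbelianPencilVHC_of_HC_AV (HC_AV_of_deligne1982_of_HC_CM_of_uniform hF hCM hU)

/-- **`HC_CM ∧ IC_MT ⟹ CPVHC`**, granted Thm. 11.5.11 (through `HC_AV`, Abdulali's Lemma 6.2 of part III §D).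
[cite: Abdulali1994FamiliesAV, Lemma 6.2 (p. 1131)] [cite: CharlesSchnell2014Notes, Thm. 11.5.11] -/
theorem compactAbelianPencilVHC_of_deligne1982_of_HC_CM_of_invariantCyclesOnMTFamilies
    (hF : deligne1982_cmDenseMumfordTateFamilies) (hCM : RankFourFaces.CMAbelianHodge)
    (hIC : ∀ (A : AbelianVariety ℂ) (p : ℕ) (c : complexBetti A.X (2 * p)) (𝒳 S : SchemeOver ℂ)
      (f : 𝒳 ⟶ S), IsCMDenseMumfordTateFamilyFor A p c f → InvariantCyclesHoldFor f A.dim) :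
    CompactAbelianPencilVHC :=
  compactAbelianPencilVHC_of_HC_AV (HC_AV_of_deligne1982_of_HC_CM_of_invariantCyclesOnMTFamilies hF hCM hIC)

/-! ## §E One-line summary: the two kinds of typed inputs on the deform axis (RING2-MAP §deform D.15) -/

/-- **The deform axis after André 1996, in one statement.** Granted the refereed facts (Charles–Schnell
Thm. 11.5.11 with density; André's Lemmes 6.3.1–6.3.3): KIND 1 (`HC_CM`-dominating) —
`HC_AV ↔ CompactAbelianPencilVHC`, `HC_AV ↔ AbelianSchemeVHC`, and `CompactAbelianPencilVHC → HC_CM`; KIND 2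
(`HC_CM`-complementary) — `HC_AV ↔ HC_CM ∧ U`, `HC_AV ↔ HC_CM ∧ H4`; and the reduction item
`CMToAbelian ↔ (HC_CM → CompactAbelianPencilVHC) ↔ (HC_CM → U)`. Every right-hand open `Prop` is a consequence of
the Hodge conjecture; `HC_CM` is a hypothesis by name throughout; no kernel theorem derives `HC_CM` from a kind-2
input. [cite: Andre1996Motifs, §6.3 and Remarque 2 (pp. 31–33)] [cite: CharlesSchnell2014Notes, Thm. 11.5.11,
Conj. 11.3.1 and Cor. 11.3.6] [cite: Deligne1982HodgeCycles, Prop. 6.1] -/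
theorem deformAxis_twoKinds (hF : deligne1982_cmDenseMumfordTateFamilies) (h₂₁ : andre1996_cmAnchoredPencil)
    (h₂₂ : andre1996_cmHodgeClasses_algebraicallyAnchoredPencils) :
    ((PadicSemiregularLift.HodgeAbelianVarieties ↔ CompactAbelianPencilVHC) ∧
      (PadicSemiregularLift.HodgeAbelianVarieties ↔ AbelianSchemeVHC) ∧
      (CompactAbelianPencilVHC → RankFourFaces.CMAbelianHodge)) ∧
    ((PadicSemiregularLift.HodgeAbelianVarieties ↔
        (RankFourFaces.CMAbelianHodge ∧ UniformAlgebraicityAtCMPoints)) ∧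
      (PadicSemiregularLift.HodgeAbelianVarieties ↔
        (RankFourFaces.CMAbelianHodge ∧ AlgebraicityLocusClosedOnCMDenseFamilies))) ∧
    ((RankFourFaces.CMToAbelian ↔ (RankFourFaces.CMAbelianHodge → CompactAbelianPencilVHC)) ∧
      (RankFourFaces.CMToAbelian ↔ (RankFourFaces.CMAbelianHodge → UniformAlgebraicityAtCMPoints))) :=
  ⟨⟨HC_AV_iff_compactAbelianPencilVHC_of_andre1996 h₂₁ h₂₂, HC_AV_iff_abelianSchemeVHC_of_andre1996 h₂₁ h₂₂,
      HC_CM_of_andre1996_of_compactAbelianPencilVHC h₂₂⟩,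
    ⟨HC_AV_iff_HC_CM_and_uniform_of_deligne1982 hF, HC_AV_iff_HC_CM_and_locusClosed_of_deligne1982 hF⟩,
    ⟨cmToAbelian_iff_HC_CM_imp_compactAbelianPencilVHC h₂₁, cmToAbelian_iff_HC_CM_imp_uniform hF⟩⟩

/-- ON-PATH for the whole file: every open `Prop` named in `deformAxis_twoKinds` follows from the Hodge
conjecture (no binder exceeds the summit). [folklore] -/
theorem deformAxis_twoKinds_inputs_of_hodgeConjecture (h : _root_.HodgeConjecture) :
    CompactAbelianPencilVHC ∧ AbelianSchemeVHC ∧ RankFourFaces.CMAbelianHodge ∧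
      UniformAlgebraicityAtCMPoints ∧ AlgebraicityLocusClosedOnCMDenseFamilies ∧
      PadicSemiregularLift.HodgeAbelianVarieties :=
  ⟨compactAbelianPencilVHC_of_hodgeConjecture h, Hypotheses.abelianSchemeVHC_of_hodgeConjecture h,
    HC_CM_of_hodgeConjecture h, uniformAlgebraicityAtCMPoints_of_hodgeConjecture h,
    algebraicityLocusClosedOnCMDenseFamilies_of_HC_AV (HC_AV_of_hodgeConjecture h), HC_AV_of_hodgeConjecture h⟩

#print axioms Summit.HodgeConjecture.HodgeConjecture.Ring2.Deform.HC_CM_of_andre1996_of_compactAbelianPencilVHC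
#print axioms Summit.HodgeConjecture.HodgeConjecture.Ring2.Deform.HC_AV_iff_compactAbelianPencilVHC_of_andre1996
#print axioms Summit.HodgeConjecture.HodgeConjecture.Ring2.Deform.HC_AV_iff_abelianSchemeVHC_of_andre1996
#print axioms Summit.HodgeConjecture.HodgeConjecture.Ring2.Deform.HC_AV_iff_HC_CM_and_compactAbelianPencilVHC_of_andre1996
#print axioms Summit.HodgeConjecture.HodgeConjecture.Ring2.Deform.cmToAbelian_iff_HC_CM_imp_compactAbelianPencilVHC
#print axioms Summit.HodgeConjecture.HodgeConjecture.Ring2.Deform.weilRungs_of_andre1996_of_abelianSchemeVHC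
#print axioms Summit.HodgeConjecture.HodgeConjecture.Ring2.Deform.deformAxis_twoKinds

end Summit.HodgeConjecture.HodgeConjecture.Ring2.Deform

end
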